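import Literature.Probability.LatticeModels.LatticeGreenPoisson
import HarnessLib

/-!
# The potential kernel of `ℤ^d` (Fourier form) and its Poisson identity `Δ a = 2 δ₀`

Topic `Literature/Probability/LatticeModels`; companion of `LatticeGreenFunction.lean`
(`latticeGreen`, `brillouin`, `dispersion`) and `LatticeGreenPoisson.lean`
(`Δ latticeGreen = -2 δ₀` for `d ≥ 3`). In dimension `d ≤ 2` the Green integrand `cos(p·x)/ε(p)`
is not integrable at `p = 0` (the walk is recurrent), and the Green function is replaced by the
**potential kernel** (Spitzer 1976, §12, P1 and §28; Lawler–Limic 2010, §4.4.1 eq. (4.36)):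

  `a(x) = (2π)^{-d} ∫_{[-π,π]^d} (1 - cos (p·x)) / ε(p) dp`,  `ε(p) = ∑ᵢ (1 - cos pᵢ)`,

whose integrand is BOUNDED on the Brillouin zone (`1 - cos (p·x) ≤ (p·x)²/2 ≤ ‖p‖²(∑ᵢ|xᵢ|)²/2`
against `ε(p) ≥ (2/π²)‖p‖²`, `potentialIntegrand_le`), so that `a` is defined in EVERY dimension.
We prove:

* `integrableOn_potentialIntegrand` — integrability on `[-π,π]^d` (all `d`);
* `latticePotentialKernel_zero`, `latticePotentialKernel_neg`, `latticePotentialKernel_nonneg` —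
  `a(0) = 0`, `a(-x) = a(x)`, `a ≥ 0`;
* **`latticeLaplacianZd_latticePotentialKernel`** — for `d ≥ 1`, `Δ a (x) = 2 · [x = 0]` for the
  graph Laplacian `Δ = latticeLaplacianZd` of `ℤ^d`: the Fourier symbol of `Δ` on `cos(p·x)` is
  `-2ε(p)` (`latticeLaplacianZd_cos_sum_mul`), so `Δ_x (1 - cos(p·x))/ε(p) = 2 cos(p·x)` off the
  null set `{p = 0}`, and orthogonality `∫ cos(p·x) dp = (2π)^d [x = 0]`
  (`integral_brillouin_cos_sum_mul`) finishes. Hence `-a/2` is a fundamental solution of the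
  Dirichlet Laplacian matrix `4·1 - A = -Δ` of `DirichletGreenFunction.lean` in `d = 2`
  (`latticeLaplacianZd_neg_half_latticePotentialKernel`), and `a` is harmonic off the origin.

In random-walk language (`d = 2`): `a = ½ ∑ₙ [P(Sₙ = 0) - P(Sₙ = x)]` is half the potential
kernel of Lawler–Limic (4.34) (whose Laplacian `P - I = Δ/4` gives `ℒa_{LL} = δ₀`, i.e.
`Δ a_{LL} = 4δ₀`); the asymptotics `a(x) = (1/π) log |x| + κ + o(1)` (Lawler–Limic Thm. 4.4.4,
Stöhr 1950, Fukai–Uchiyama 1996) are the business of the companion files on the heat-kernel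
representation. Everything here is proved; no named fact is introduced.

## References

* F. Spitzer, *Principles of Random Walk*, 2nd ed. (1976), §12 P1, P3 (potential kernel as a
  Fourier integral).
* G. F. Lawler, V. Limic, *Random Walk: A Modern Introduction* (2010), §4.4.1, (4.34)–(4.36) and
  Thm. 4.4.4 [LawlerLimic2010].
-/

noncomputable section

open MeasureTheory Finset Real Filter

namespace Literature.Probability.LatticeModels

variable {d : ℕ}

/-! ### The integrand and its bound -/

/-- The potential-kernel integrand `(1 - cos (p·x)) / ε(p)` (`p·x = ∑ᵢ pᵢ xᵢ`; value `0` at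
`ε(p) = 0` by `x/0 = 0`). [cite: LawlerLimic2010, §4.4.1 eq. (4.36)] -/
def potentialIntegrand (x : Site d) (p : Fin d → ℝ) : ℝ :=
  (1 - Real.cos (∑ j, p j * (x j : ℝ))) / dispersion p

variable (d) in
/-- The **potential kernel** of `ℤ^d` in Fourier form,
`a(x) = (2π)^{-d} ∫_{[-π,π]^d} (1 - cos (p·x)) / ε(p) dp` (Spitzer 1976, §12; Lawler–Limic 2010,
(4.36), up to the normalisation `Δ a = 2δ₀` of this file). [cite: LawlerLimic2010, §4.4.1 eq. (4.36)] -/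
def latticePotentialKernel (x : Site d) : ℝ :=
  (∫ p in brillouin d, potentialIntegrand x p) / ((2 * π) ^ d)

/-- `latticePotentialKernel` unfolded. [folklore] -/
theorem latticePotentialKernel_eq (x : Site d) :
    latticePotentialKernel d x = (∫ p in brillouin d, potentialIntegrand x p) / ((2 * π) ^ d) := rfl

/-- The phase is bounded by the sup norm of the momentum: `|p·x| ≤ ‖p‖ ∑ᵢ |xᵢ|`. [folklore] -/
theorem abs_sum_mul_le_norm_mul (p : Fin d → ℝ) (x : Site d) :
    |∑ j, p j * (x j : ℝ)| ≤ ‖p‖ * ∑ j, |(x j : ℝ)| := by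
  calc |∑ j, p j * (x j : ℝ)| ≤ ∑ j, |p j * (x j : ℝ)| := Finset.abs_sum_le_sum_abs _ _
    _ = ∑ j, |p j| * |(x j : ℝ)| := Finset.sum_congr rfl fun j _ => abs_mul _ _
    _ ≤ ∑ j, ‖p‖ * |(x j : ℝ)| := Finset.sum_le_sum fun j _ =>
        mul_le_mul_of_nonneg_right (by rw [← Real.norm_eq_abs]; exact norm_le_pi_norm p j)
          (abs_nonneg _)
    _ = ‖p‖ * ∑ j, |(x j : ℝ)| := by rw [Finset.mul_sum]

/-- The potential-kernel integrand is nonnegative on the Brillouin zone. [folklore] -/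
theorem potentialIntegrand_nonneg (x : Site d) (p : Fin d → ℝ) : 0 ≤ potentialIntegrand x p :=
  div_nonneg (sub_nonneg.2 (Real.cos_le_one _)) (dispersion_nonneg p)

/-- **The potential-kernel integrand is bounded on the Brillouin zone**:
`(1 - cos (p·x))/ε(p) ≤ (π²/4) (∑ᵢ |xᵢ|)²` for `p ∈ [-π,π]^d`
(`1 - cos θ ≤ θ²/2`, `|p·x| ≤ ‖p‖ ∑|xᵢ|`, `ε(p) ≥ (2/π²)‖p‖²`). [folklore] -/
theorem potentialIntegrand_le {p : Fin d → ℝ} (hp : p ∈ brillouin d) (x : Site d) :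
    potentialIntegrand x p ≤ π ^ 2 / 4 * (∑ j, |(x j : ℝ)|) ^ 2 := by
  set S : ℝ := ∑ j, |(x j : ℝ)| with hS
  have hS0 : 0 ≤ S := Finset.sum_nonneg fun j _ => abs_nonneg _
  have hC : 0 ≤ π ^ 2 / 4 * S ^ 2 := by positivity
  by_cases hp0 : p = 0
  · subst hp0
    simp only [potentialIntegrand, Pi.zero_apply, zero_mul, Finset.sum_const_zero, Real.cos_zero,
      sub_self, zero_div]
    exact hC
  have hε : 0 < dispersion p := dispersion_pos_of_mem_brillouin hp hp0
  have hnorm : 0 < ‖p‖ := norm_pos_iff.2 hp0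
  set θ : ℝ := ∑ j, p j * (x j : ℝ) with hθ
  have hθle : |θ| ≤ ‖p‖ * S := abs_sum_mul_le_norm_mul p x
  have hcos : 1 - Real.cos θ ≤ θ ^ 2 / 2 := by linarith [Real.one_sub_sq_div_two_le_cos (x := θ)]
  have hθsq : θ ^ 2 ≤ (‖p‖ * S) ^ 2 := by
    calc θ ^ 2 = |θ| ^ 2 := (sq_abs θ).symm
      _ ≤ (‖p‖ * S) ^ 2 := by gcongr
  have hdisp := mul_norm_sq_le_dispersion hp
  rw [potentialIntegrand, div_le_iff₀ hε]
  have hπ : (0 : ℝ) < π ^ 2 := by positivity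
  calc 1 - Real.cos θ ≤ (‖p‖ * S) ^ 2 / 2 := hcos.trans (by linarith)
    _ = π ^ 2 / 4 * S ^ 2 * (2 / π ^ 2 * ‖p‖ ^ 2) := by field_simp; ring
    _ ≤ π ^ 2 / 4 * S ^ 2 * dispersion p := by gcongr

/-- The potential-kernel integrand is measurable in the momentum. [folklore] -/
theorem measurable_potentialIntegrand (x : Site d) : Measurable (potentialIntegrand x) := by
  unfold potentialIntegrand dispersion
  fun_prop

variable (d) in
/-- **The potential-kernel integrand is integrable on the Brillouin zone** (every `d`): it is
measurable and bounded on a set of finite measure. [folklore] -/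
theorem integrableOn_potentialIntegrand (x : Site d) :
    IntegrableOn (potentialIntegrand x) (brillouin d) := by
  refine Measure.integrableOn_of_bounded (isCompact_brillouin d).measure_lt_top.ne
    (measurable_potentialIntegrand x).aestronglyMeasurable
    (M := π ^ 2 / 4 * (∑ j, |(x j : ℝ)|) ^ 2) ?_
  filter_upwards [ae_restrict_mem (measurableSet_brillouin d)] with p hp
  rw [Real.norm_eq_abs, abs_of_nonneg (potentialIntegrand_nonneg x p)]
  exact potentialIntegrand_le hp x

/-! ### Elementary properties -/

variable (d) in
/-- `a(0) = 0`. [cite: LawlerLimic2010, §4.4.1] -/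
theorem latticePotentialKernel_zero : latticePotentialKernel d 0 = 0 := by
  simp [latticePotentialKernel, potentialIntegrand]

/-- `a(-x) = a(x)`. [cite: LawlerLimic2010, §4.4.1] -/
theorem latticePotentialKernel_neg (x : Site d) :
    latticePotentialKernel d (-x) = latticePotentialKernel d x := by
  simp only [latticePotentialKernel, potentialIntegrand, Pi.neg_apply, Int.cast_neg, mul_neg,
    Finset.sum_neg_distrib, Real.cos_neg]

variable (d) in
/-- `a ≥ 0`. [cite: LawlerLimic2010, §4.4.1] -/
theorem latticePotentialKernel_nonneg (x : Site d) : 0 ≤ latticePotentialKernel d x :=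
  div_nonneg (setIntegral_nonneg (measurableSet_brillouin d)
    fun p _ => potentialIntegrand_nonneg x p) (by positivity)

/-! ### The Poisson identity -/

/-- The graph Laplacian acting on the lattice variable of the potential-kernel integrand: off
`ε(p) = 0`, `Δ_z [(1 - cos (p·z))/ε(p)] (x) = 2 cos (p·x)` (the constant `1/ε(p)` is killed and
`Δ_z cos(p·z) = -2ε(p) cos(p·z)`). [folklore] -/
theorem latticeLaplacianZd_potentialIntegrand {p : Fin d → ℝ} (hp : dispersion p ≠ 0)
    (x : Site d) :
    latticeLaplacianZd (fun z => potentialIntegrand z p) x = 2 * Real.cos (∑ j, p j * (x j : ℝ)) := by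
  have hfun : (fun z => potentialIntegrand z p) =
      fun z => (-1 : ℝ) * greenIntegrand z p + (dispersion p)⁻¹ := by
    funext z
    rw [potentialIntegrand, greenIntegrand, sub_div, div_eq_inv_mul (1 : ℝ), mul_one]
    ring
  rw [hfun, latticeLaplacianZd_add_const, latticeLaplacianZd_const_mul,
    latticeLaplacianZd_greenIntegrand hp x]
  ring

variable (d) in
/-- **The Poisson identity for the potential kernel** (`d ≥ 1`): `Δ a (x) = 2 · [x = 0]` for the
graph Laplacian `Δ = latticeLaplacianZd` of `ℤ^d` (Lawler–Limic 2010, Prop. 4.4.2: `ℒ a = δ₀` for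
the walk Laplacian `ℒ = Δ/(2d)` and their kernel, which is `d` times the present one; with the
normalisation `a = (2π)^{-d}∫(1 - cos)/ε` the symbol computation gives the factor `2` in every
dimension). Proof: linearity of the
integral (`integrableOn_potentialIntegrand`), the pointwise identity
`latticeLaplacianZd_potentialIntegrand` off the null set `{p = 0}`, and orthogonality
`integral_brillouin_cos_sum_mul`. [cite: LawlerLimic2010, §4.4.1, Prop. 4.4.2] -/
theorem latticeLaplacianZd_latticePotentialKernel (hd : 0 < d) (x : Site d) :
    latticeLaplacianZd (latticePotentialKernel d) x = 2 * (if x = 0 then 1 else 0) := by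
  have hI : ∀ z : Site d, Integrable (potentialIntegrand z)
      ((volume : Measure (Fin d → ℝ)).restrict (brillouin d)) :=
    fun z => integrableOn_potentialIntegrand d z
  -- Step 1: pull the (finite) linear combination out of the integrals
  have step1 : latticeLaplacianZd (latticePotentialKernel d) x =
      ((∑ i, ((∫ p in brillouin d, potentialIntegrand (x + Pi.single i 1) p) +
          ∫ p in brillouin d, potentialIntegrand (x - Pi.single i 1) p)) -
        2 * d * ∫ p in brillouin d, potentialIntegrand x p) / (2 * π) ^ d := by
    simp only [latticeLaplacianZd, latticePotentialKernel_eq, sub_div, Finset.sum_div, add_div]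
    ring
  have hF : ∀ i ∈ (univ : Finset (Fin d)), Integrable
      (fun p => potentialIntegrand (x + Pi.single i 1) p + potentialIntegrand (x - Pi.single i 1) p)
      ((volume : Measure (Fin d → ℝ)).restrict (brillouin d)) := fun i _ => (hI _).add (hI _)
  have hsumI : Integrable (fun p => ∑ i, (potentialIntegrand (x + Pi.single i 1) p +
      potentialIntegrand (x - Pi.single i 1) p))
      ((volume : Measure (Fin d → ℝ)).restrict (brillouin d)) :=
    integrable_finsetSum univ hF
  have hcI : Integrable (fun p => 2 * d * potentialIntegrand x p)
      ((volume : Measure (Fin d → ℝ)).restrict (brillouin d)) := (hI x).const_mul _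
  have step2 : ∫ p in brillouin d, ((∑ i, (potentialIntegrand (x + Pi.single i 1) p +
          potentialIntegrand (x - Pi.single i 1) p)) - 2 * d * potentialIntegrand x p) =
      (∑ i, ((∫ p in brillouin d, potentialIntegrand (x + Pi.single i 1) p) +
          ∫ p in brillouin d, potentialIntegrand (x - Pi.single i 1) p)) -
        2 * d * ∫ p in brillouin d, potentialIntegrand x p := by
    rw [integral_sub hsumI hcI, integral_finsetSum univ hF, integral_const_mul]
    congr 1
    exact Finset.sum_congr rfl fun i _ => integral_add (hI _) (hI _)
  -- Step 2: the integrand is `Δ_z [(1 - cos(p·z))/ε(p)] (x) = 2 cos (p·x)` off the null set `{p = 0}`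
  have hae : ∀ᵐ p ∂((volume : Measure (Fin d → ℝ)).restrict (brillouin d)),
      ((∑ i, (potentialIntegrand (x + Pi.single i 1) p + potentialIntegrand (x - Pi.single i 1) p)) -
        2 * d * potentialIntegrand x p) = 2 * Real.cos (∑ j, p j * (x j : ℝ)) := by
    have h0 := ae_restrict_of_ae (s := brillouin d) (ae_ne_zero_volume_pi (d := d) hd)
    have hB : ∀ᵐ p ∂((volume : Measure (Fin d → ℝ)).restrict (brillouin d)), p ∈ brillouin d :=
      ae_restrict_mem (measurableSet_brillouin d)
    filter_upwards [h0, hB] with p hp0 hpB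
    have hε : dispersion p ≠ 0 := (dispersion_pos_of_mem_brillouin hpB hp0).ne'
    have key := latticeLaplacianZd_potentialIntegrand hε x
    simp only [latticeLaplacianZd] at key
    exact key
  -- Step 3: orthogonality
  rw [step1, ← step2, integral_congr_ae hae, integral_const_mul, integral_brillouin_cos_sum_mul]
  have hπ : (2 * π) ^ d ≠ 0 := by positivity
  split_ifs
  · rw [mul_div_assoc, div_self hπ]
  · rw [mul_zero, zero_div]

variable (d) in
/-- `Δ a (x) = 0` for `x ≠ 0`: the potential kernel is harmonic off the origin (`d ≥ 1`).
[cite: LawlerLimic2010, §4.4.1, Prop. 4.4.2] -/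
theorem latticeLaplacianZd_latticePotentialKernel_of_ne_zero (hd : 0 < d) {x : Site d}
    (hx : x ≠ 0) : latticeLaplacianZd (latticePotentialKernel d) x = 0 := by
  rw [latticeLaplacianZd_latticePotentialKernel d hd x, if_neg hx, mul_zero]

variable (d) in
/-- `Δ a (0) = 2` (`d ≥ 1`). [cite: LawlerLimic2010, §4.4.1, Prop. 4.4.2] -/
theorem latticeLaplacianZd_latticePotentialKernel_zero (hd : 0 < d) :
    latticeLaplacianZd (latticePotentialKernel d) (0 : Site d) = 2 := by
  rw [latticeLaplacianZd_latticePotentialKernel d hd 0, if_pos rfl, mul_one]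

variable (d) in
/-- The potential kernel is harmonic on `ℤ^d ∖ {0}` (`d ≥ 1`). [cite: LawlerLimic2010, §4.4.1, Prop. 4.4.2] -/
theorem isZdHarmonicOn_latticePotentialKernel (hd : 0 < d) :
    IsZdHarmonicOn (latticePotentialKernel d) {0}ᶜ := fun _ hx =>
  latticeLaplacianZd_latticePotentialKernel_of_ne_zero d hd hx

variable (d) in
/-- The potential kernel is subharmonic on all of `ℤ^d` (`d ≥ 1`): `Δ a ≥ 0`.
[cite: LawlerLimic2010, §4.4.1, Prop. 4.4.2] -/
theorem isZdSubharmonicOn_latticePotentialKernel (hd : 0 < d) :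
    IsZdSubharmonicOn (latticePotentialKernel d) Set.univ := fun x _ => by
  rw [latticeLaplacianZd_latticePotentialKernel d hd x]
  split_ifs <;> norm_num

variable (d) in
/-- **`-a/2` is a fundamental solution of `-Δ`** (`d ≥ 1`): `(-Δ)(-a/2) (x) = [x = 0]`, i.e.
`x ↦ -a(x - y)/2` inverts the Dirichlet Laplacian matrix `2d·1 - A = -Δ` of
`DirichletGreenFunction.lean` at the site `y`, up to a harmonic correction. This is the form in
which the potential kernel replaces the (divergent) Green function in `d = 2`
(Lawler–Limic 2010, §4.4 and Prop. 4.6.2–4.6.3). [cite: LawlerLimic2010, §4.4.1, Prop. 4.4.2] -/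
theorem latticeLaplacianZd_neg_half_latticePotentialKernel (hd : 0 < d) (x : Site d) :
    -latticeLaplacianZd (fun z => -(latticePotentialKernel d z / 2)) x = if x = 0 then 1 else 0 := by
  have h : (fun z : Site d => -(latticePotentialKernel d z / 2)) =
      fun z => (-(1 / 2) : ℝ) * latticePotentialKernel d z := by
    funext z; ring
  rw [h, latticeLaplacianZd_const_mul, latticeLaplacianZd_latticePotentialKernel d hd x]
  ring

end Literature.Probability.LatticeModels
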